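import Summits.ResolutionOfSingularities.ResolutionOfSingularities.Theorems.WeightedInvariantIota3TauDescentAdmStep
import Summits.ResolutionOfSingularities.ResolutionOfSingularities.Theorems.WeightedInvariantIota3TauDescentAdmDatum
import HarnessLib

/-!
# (desc-τ) IN THE DOOR SETTING, UNCONDITIONAL: (ADAPT-adm) proved — an rsp-adapted admissible pair downstairs from a steep tie upstairs
# (door `HypersurfaceCentreConstruction`, stmt-ResolutionOfSingularities-19897; gap (1) (desc-τ) of the P3 rung `stub_keyRungGrHomLE_three`)

Topic: `Summits/ResolutionOfSingularities/ResolutionOfSingularities/Theorems`. Helper for the door item `HypersurfaceCentreConstruction`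
(stmt-ResolutionOfSingularities-19897, route `WeightedInvariant`), line `local-engine`, def-free.  …Iota3TauDescentDoorAdm reduced (desc-τ) for bases
essentially of finite type over a field to (ADAPT-adm); THIS FILE proves (ADAPT-adm) and assembles:

* **`Iota3.exists_adapted_admissible`** — (ADAPT-adm): for `q < r` some regular system of parameters `(x, y, z)` of `T` with `(x, y) = P₀(T, g)` has
  `g/1 ∈ 𝒥_{rν}((y/1, x/1); (r, q))` (first-order step …FirstOrder, induction …AdmStep along `k = 2, …, m`, `m` least with `mq ≥ r`, then the jets
  lemma `weightedMonomialIdeal_le_of_forall_mem`).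
* **`Iota3.isTiePosition_descent_door`** — (desc-τ) for `T` essentially of finite type over a field: `IsTiePosition T' (φ g) → IsTiePosition T g` for
  every local, formally smooth, essentially-of-finite-type `φ : T → T'` of regular local rings with `dim T' ≤ 3`.  UNCONDITIONAL.

[OURS · L1 W4.3 · (desc-τ) door setting, unconditional]  Replaces the role of NO printed item; NOT a statement of the manuscript under review
[claim: Hironaka2017, status: under-review]; candidates stay candidates; AI work, weaker than expert review.  No definition; no axiom.

## References

* D. Abramovich, M. H. Quek, B. Schober, arXiv:2507.01232 (2025), Thm 1.3, Thm 3.5. [AbramovichQuekSchober2025]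
* H. Matsumura, *Commutative Ring Theory* (1986), Thm. 7.5, Thm. 11.2, Thm. 14.2. [Matsumura1987]
-/

noncomputable section

set_option linter.dupNamespace false -- mandated namespace `Summit.<Summit>.<Problem>` of this single-conjunct summit

open IsLocalRing Literature.AlgebraicGeometry.Resolution
open Summit.ResolutionOfSingularities.ResolutionOfSingularities.Theorems
open Summit.ResolutionOfSingularities.ResolutionOfSingularities.Theorems.ContactCylinder

namespace Summit.ResolutionOfSingularities.ResolutionOfSingularities.Cruxes.HypersurfaceCentreConstruction.LocalEngine

namespace Iota3

/-! ## (ADAPT-adm) and the unconditional (desc-τ) in the door setting -/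

section Adm

variable (T T' : Type) [CommRing T] [CommRing T'] [IsRegularLocalRing T] [IsRegularLocalRing T'] [Algebra T T']
  [IsLocalHom (algebraMap T T')] [Algebra.FormallySmooth T T'] [Algebra.EssFiniteType T T']

omit [IsRegularLocalRing T] in
/-- Transport of the admissibility clause along an equality of primes. [folklore] -/
theorem exists_adm_of_eq {I J : Ideal T} [hI : I.IsPrime] (hIJ : I = J) {g a b : T} {w : Fin 2 → ℕ} {n : ℕ}
    (hm : algebraMap T (Localization.AtPrime I) g ∈
      weightedMonomialIdeal ![algebraMap T (Localization.AtPrime I) a, algebraMap T (Localization.AtPrime I) b] w n) :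
    ∃ (_ : J.IsPrime), algebraMap T (Localization.AtPrime J) g ∈
      weightedMonomialIdeal ![algebraMap T (Localization.AtPrime J) a, algebraMap T (Localization.AtPrime J) b] w n := by
  subst hIJ; exact ⟨hI, hm⟩

omit [IsRegularLocalRing T] in
/-- `(v, a₁ u + a₂ v) = (u, v)` for a unit `a₁`. [folklore] -/
theorem span_pair_eq_of_isUnit {a₁ : T} (ha₁ : IsUnit a₁) (a₂ u v : T) :
    Ideal.span ({v, a₁ * u + a₂ * v} : Set T) = Ideal.span {u, v} := by
  obtain ⟨a, rfl⟩ := ha₁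
  refine le_antisymm ?_ ?_
  · rw [Ideal.span_le, Set.insert_subset_iff, Set.singleton_subset_iff]
    exact ⟨Ideal.subset_span (Set.mem_insert_of_mem _ (Set.mem_singleton _)), Ideal.mem_span_pair.mpr ⟨↑a, a₂, rfl⟩⟩
  · rw [Ideal.span_le, Set.insert_subset_iff, Set.singleton_subset_iff]
    refine ⟨Ideal.mem_span_pair.mpr ⟨-(↑a⁻¹ * a₂), ↑a⁻¹, ?_⟩, Ideal.subset_span (Set.mem_insert _ _)⟩
    rw [mul_add, ← mul_assoc (↑a⁻¹ : T) (↑a : T) u, Units.inv_mul, one_mul]; ring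

/-- **(ADAPT-adm).**  See the module docstring. [OURS · (desc-τ) case B] [cite: AbramovichQuekSchober2025, Thm 3.5]
[cite: Matsumura1987, Thm. 11.2, Thm. 14.2] -/
theorem exists_adapted_admissible (k₀ : Type) [Field k₀] [Algebra k₀ T] [Algebra.EssFiniteType k₀ T]
    (hdimT : ringKrullDim T = (3 : ℕ)) {g : T} (ht' : IsTiePosition T' (algebraMap T T' g))
    {x' y' z' : T'} {q r : ℕ} {lam' : T'} (h' : IsTiePresentation T' (algebraMap T T' g) x' y' z' q r lam') (hqr : q < r)
    {ν : ℕ} (hfν : algebraMap T T' g ∈ maximalIdeal T' ^ ν) (hfν1 : algebraMap T T' g ∉ maximalIdeal T' ^ (ν + 1)) :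
    ∃ (x y z : T) (_ : (Ideal.span ({x, y} : Set T)).IsPrime),
      Ideal.span {x, y, z} = maximalIdeal T ∧ topStratumPrime iotaOrdEps T g = Ideal.span {x, y} ∧
      algebraMap T (Localization.AtPrime (Ideal.span ({x, y} : Set T))) g ∈
        weightedMonomialIdeal ![algebraMap T (Localization.AtPrime (Ideal.span ({x, y} : Set T))) y,
          algebraMap T (Localization.AtPrime (Ideal.span ({x, y} : Set T))) x] ![r, q] (r * ν) := by
  classical
  haveI := isDomain_of_isRegularLocalRing T
  have hdim3 : ringKrullDim T = 3 := by rw [hdimT]; rfl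
  obtain ⟨hgν, hgν1⟩ := mem_pow_and_not_mem_of_map T T' hfν hfν1
  have hg0 : g ≠ 0 := fun h0 => ht'.ne_zero (by rw [h0, map_zero])
  have hg𝔪 : g ∈ maximalIdeal T := by
    refine (IsLocalRing.mem_maximalIdeal g).mpr (mem_nonunits_iff.mpr fun hu => ?_)
    exact (IsLocalRing.mem_maximalIdeal _).mp ht'.mem_maximalIdeal (hu.map (algebraMap T T'))
  have hν : iotaOrd T g = ν := (iotaOrd_eq_natCast_iff T g ν).mpr ⟨hgν, hgν1⟩
  obtain ⟨hP₀p, hreg, -, -, -, hmemν⟩ := topStratumPrime_iotaOrdEps_spec (le_of_eq hdim3) hg0 hg𝔪 hν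
  haveI := hP₀p
  haveI := hreg
  have hq1 := ringKrullDim_quotient_topStratumPrime_eq_one_of_isTiePosition_map T T' hdimT ht'
  obtain ⟨u, v, z, huvz, huv⟩ := exists_rsp_adapted hdimT (topStratumPrime iotaOrdEps T g) hq1
  haveI hPuv : (Ideal.span ({u, v} : Set T)).IsPrime := by rw [huv]; exact hP₀p
  haveI hregP : IsRegularLocalRing (T ⧸ Ideal.span ({u, v} : Set T)) := by rw [huv]; exact hreg
  have hq1' : ringKrullDim (T ⧸ Ideal.span ({u, v} : Set T)) = 1 := by
    have hcongr : ∀ (I J : Ideal T), I = J → ringKrullDim (T ⧸ I) = ringKrullDim (T ⧸ J) := by rintro I J rfl; rfl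
    rw [hcongr _ _ huv]; exact hq1
  have hmemν' : g ∈ Ideal.span ({u, v} : Set T) ^ ν := by rw [huv]; exact hmemν
  have hPle : Ideal.span ({u, v} : Set T) ≤ maximalIdeal T := IsLocalRing.le_maximalIdeal (Ideal.IsPrime.ne_top hPuv)
  set O := Localization.AtPrime (Ideal.span ({u, v} : Set T)) with hO
  set φ := algebraMap T O with hφ
  obtain ⟨hq, hν1, hdimO, y₁, x₁, hx₁y₁, hadm⟩ := exists_aqs_datum_atPrime T T' k₀ hdimT ht' h' hfν hfν1 huv.symm
  haveI : IsRegularLocalRing O := isRegularLocalRing_localization_atPrime T _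
  have h𝔪O : Ideal.span {φ u, φ v} = maximalIdeal O := by rw [← map_span_pair, Localization.AtPrime.map_eq_maximalIdeal]
  have hx₁𝔪 : x₁ ∈ maximalIdeal O := hx₁y₁ ▸ Ideal.subset_span (Set.mem_insert _ _)
  have hy₁𝔪 : y₁ ∈ maximalIdeal O := hx₁y₁ ▸ Ideal.subset_span (Set.mem_insert_of_mem _ (Set.mem_singleton _))
  obtain ⟨-, hy₁2⟩ := LocalGameEFTSteepening.not_mem_sq_of_span_pair_eq hdimO hx₁y₁
  -- BASE CASE (first order): `y₁ = t / s₀`, `t = t₁ u + t₂ v`, primitive representative `z₀ⁿ (a₁ u + a₂ v)`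
  obtain ⟨⟨t, s₀⟩, hts⟩ := IsLocalization.surj (Ideal.span ({u, v} : Set T)).primeCompl y₁
  have hs₀u : IsUnit (φ (s₀ : T)) := IsLocalization.map_units O s₀
  have hφt : φ t ∈ maximalIdeal O := by
    change algebraMap T O t ∈ _
    rw [← hts]; exact Ideal.mul_mem_right _ _ hy₁𝔪
  have htP : t ∈ Ideal.span ({u, v} : Set T) := by
    by_contra h
    exact (IsLocalRing.mem_maximalIdeal _).mp hφt (IsLocalization.map_units O
      (⟨t, show t ∈ (Ideal.span ({u, v} : Set T)).primeCompl from h⟩ : (Ideal.span ({u, v} : Set T)).primeCompl))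
  obtain ⟨t₁, t₂, ht⟩ := Ideal.mem_span_pair.mp htP
  have ht12 : ¬ (t₁ ∈ Ideal.span ({u, v} : Set T) ∧ t₂ ∈ Ideal.span ({u, v} : Set T)) := fun ⟨h1, h2⟩ => by
    have htP2 : t ∈ Ideal.span ({u, v} : Set T) ^ 2 := by
      rw [← ht, pow_two]
      exact Ideal.add_mem _ (Ideal.mul_mem_mul h1 (Ideal.subset_span (Set.mem_insert _ _)))
        (Ideal.mul_mem_mul h2 (Ideal.subset_span (Set.mem_insert_of_mem _ (Set.mem_singleton _))))
    apply hy₁2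
    have h3 : φ t ∈ maximalIdeal O ^ 2 := by
      rw [← Localization.AtPrime.map_eq_maximalIdeal, ← Ideal.map_pow]; exact Ideal.mem_map_of_mem _ htP2
    rw [← hts] at h3
    exact (Ideal.mul_unit_mem_iff_mem _ hs₀u).mp h3
  obtain ⟨z₀, n, a₁, a₂, hz₀P, ha, h₁, h₂⟩ := exists_primitive_pair_mod (Ideal.span ({u, v} : Set T)) hq1' ht12
  have hsub := sub_mem_mul_of_primitive_pair h₁ h₂ u v
  rw [ht] at hsub
  set Y₂ : T := a₁ * u + a₂ * v with hY₂
  -- the transversal parameter `X₀ ∈ {u, v}` complementary to `Y₂`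
  obtain ⟨X₀, hX₀Y₂, hX₀uv⟩ : ∃ X₀ : T, Ideal.span ({X₀, Y₂} : Set T) = Ideal.span {u, v} ∧ (X₀ = u ∨ X₀ = v) := by
    by_cases ha₁ : a₁ ∈ maximalIdeal T
    · have ha₂ : IsUnit a₂ := by
        by_contra h; exact ha ⟨ha₁, (IsLocalRing.mem_maximalIdeal _).mpr (mem_nonunits_iff.mpr h)⟩
      refine ⟨u, ?_, Or.inl rfl⟩
      rw [hY₂, add_comm, span_pair_eq_of_isUnit T ha₂, Ideal.span_pair_comm]
    · have ha₁u : IsUnit a₁ := by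
        by_contra h; exact ha₁ ((IsLocalRing.mem_maximalIdeal _).mpr (mem_nonunits_iff.mpr h))
      exact ⟨v, by rw [hY₂, span_pair_eq_of_isUnit T ha₁u], Or.inr rfl⟩
  have hX₀𝔪 : X₀ ∈ maximalIdeal T := by
    rcases hX₀uv with rfl | rfl
    · exact hPle (Ideal.subset_span (Set.mem_insert _ _))
    · exact hPle (Ideal.subset_span (Set.mem_insert_of_mem _ (Set.mem_singleton _)))
  have hz𝔪 : z ∈ maximalIdeal T := huvz ▸ Ideal.subset_span (Set.mem_insert_of_mem _ (Set.mem_insert_of_mem _ (Set.mem_singleton _)))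
  -- `(X₀, Y, z)` is a regular system of parameters whenever `(X₀, Y) = (u, v)`
  have hsplit : ∀ A B : T, Ideal.span ({A, B, z} : Set T) = Ideal.span {A, B} ⊔ Ideal.span {z} := fun A B => by
    simp only [Ideal.span_insert, sup_assoc]
  have hrsp : ∀ Y : T, Ideal.span ({X₀, Y} : Set T) = Ideal.span {u, v} → Ideal.span {X₀, Y, z} = maximalIdeal T := by
    intro Y hXY
    rw [hsplit, hXY, ← hsplit, huvz]
  have hnot2 : ∀ Y : T, Ideal.span ({X₀, Y} : Set T) = Ideal.span {u, v} → Y ∉ maximalIdeal T ^ 2 := by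
    intro Y hXY
    have hr3 : Ideal.span (Set.range ![Y, X₀, z]) = maximalIdeal T := by
      rw [← hrsp Y hXY, Matrix.range_cons, Matrix.range_cons, Matrix.range_cons, Matrix.range_empty, Set.union_empty,
        Set.singleton_union, Set.singleton_union, Set.insert_comm]
    exact TieFinite.not_mem_sq_of_span_range_eq ![Y, X₀, z] hr3 hdim3 0
  have h𝔪O' : ∀ Y : T, Ideal.span ({X₀, Y} : Set T) = Ideal.span {u, v} → Ideal.span {φ X₀, φ Y} = maximalIdeal O := by
    intro Y hXY
    rw [← map_span_pair, hXY, Localization.AtPrime.map_eq_maximalIdeal]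
  -- `Y₂/1 ∈ (y₁, X₀²) O`
  have hφX₀𝔪 : φ X₀ ∈ maximalIdeal O := (h𝔪O' Y₂ hX₀Y₂) ▸ Ideal.subset_span (Set.mem_insert _ _)
  have hsq : ∀ m ∈ maximalIdeal O ^ 2, ∃ lam ∈ maximalIdeal O, ∃ μ : O, m = lam * φ Y₂ + μ * φ X₀ ^ 2 := by
    intro m hm
    rw [pow_two] at hm
    refine Submodule.mul_induction_on hm ?_ ?_
    · intro m₁ hm₁ n₁ hn₁
      have hm₁' := hm₁
      rw [← h𝔪O' Y₂ hX₀Y₂] at hm₁' hn₁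
      obtain ⟨a, b, rfl⟩ := Ideal.mem_span_pair.mp hm₁'
      obtain ⟨c, d, rfl⟩ := Ideal.mem_span_pair.mp hn₁
      refine ⟨(a * φ X₀ + b * φ Y₂) * d + b * c * φ X₀, Ideal.add_mem _ (Ideal.mul_mem_right _ _ hm₁)
        (Ideal.mul_mem_left _ _ hφX₀𝔪), a * c, by ring⟩
    · rintro m₁ m₂ ⟨l₁, hl₁, μ₁, rfl⟩ ⟨l₂, hl₂, μ₂, rfl⟩
      exact ⟨l₁ + l₂, Ideal.add_mem _ hl₁ hl₂, μ₁ + μ₂, by ring⟩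
  have hY₂2 : φ Y₂ ∈ Ideal.span {y₁, φ X₀ ^ 2} := by
    have hp : φ (t - z₀ ^ n * Y₂) ∈ maximalIdeal O ^ 2 := by
      rw [← Localization.AtPrime.map_eq_maximalIdeal, ← Ideal.map_pow, pow_two]
      exact Ideal.mem_map_of_mem _ hsub
    obtain ⟨lam, hlam, μ, hμ⟩ := hsq _ hp
    have hz₀u : IsUnit (φ (z₀ ^ n)) := IsLocalization.map_units O
      (⟨z₀ ^ n, show z₀ ^ n ∈ (Ideal.span ({u, v} : Set T)).primeCompl from fun h => hz₀P (hPuv.mem_of_pow_mem n h)⟩ :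
        (Ideal.span ({u, v} : Set T)).primeCompl)
    have hunit : IsUnit (φ (z₀ ^ n) + lam) := by
      by_contra hnu
      have hmem : φ (z₀ ^ n) + lam ∈ maximalIdeal O := (IsLocalRing.mem_maximalIdeal _).mpr (mem_nonunits_iff.mpr hnu)
      have : φ (z₀ ^ n) ∈ maximalIdeal O := by
        have h := Ideal.sub_mem _ hmem hlam
        rwa [add_sub_cancel_right] at h
      exact (IsLocalRing.mem_maximalIdeal _).mp this hz₀u
    have hkey : φ Y₂ * (φ (z₀ ^ n) + lam) = φ (s₀ : T) * y₁ + (-μ) * φ X₀ ^ 2 := by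
      have h1 : φ t = y₁ * φ (s₀ : T) := hts.symm
      have h2 : φ (t - z₀ ^ n * Y₂) = φ t - φ (z₀ ^ n) * φ Y₂ := by
        rw [map_sub, map_mul]
      rw [h2, h1] at hμ
      linear_combination -hμ
    rw [← Ideal.mul_unit_mem_iff_mem _ hunit, hkey]
    exact Ideal.mem_span_pair.mpr ⟨_, _, rfl⟩
  -- replacing `x₁` by `X₀/1`
  have hadm' : φ g ∈ weightedMonomialIdeal ![y₁, φ X₀] ![r, q] (r * ν) := by
    refine weightedMonomialIdeal_le_of_forall_mem ![y₁, φ X₀] ![y₁, x₁] ![r, q] (fun i => ?_) (r * ν) hadm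
    fin_cases i
    · exact Ideal.subset_span ⟨![1, 0], by simp, by simp⟩
    · -- `x₁ ∈ 𝔪_O = (X₀, Y₂) O ≤ (y₁, X₀) O ≤ 𝒥_q`
      have hX₀q : φ X₀ ∈ weightedMonomialIdeal ![y₁, φ X₀] ![r, q] q := Ideal.subset_span ⟨![0, 1], by simp, by simp⟩
      have hy₁q : y₁ ∈ weightedMonomialIdeal ![y₁, φ X₀] ![r, q] q :=
        weightedMonomialIdeal_antitone _ _ hqr.le (Ideal.subset_span ⟨![1, 0], by simp, by simp⟩)
      have hY₂q : φ Y₂ ∈ weightedMonomialIdeal ![y₁, φ X₀] ![r, q] q := by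
        obtain ⟨a, b, hab⟩ := Ideal.mem_span_pair.mp hY₂2
        rw [← hab, pow_two, ← mul_assoc]
        exact Ideal.add_mem _ (Ideal.mul_mem_left _ _ hy₁q) (Ideal.mul_mem_left _ _ hX₀q)
      have hx : x₁ ∈ Ideal.span ({φ X₀, φ Y₂} : Set O) := (h𝔪O' Y₂ hX₀Y₂).symm ▸ hx₁𝔪
      obtain ⟨a, b, hab⟩ := Ideal.mem_span_pair.mp hx
      change x₁ ∈ _
      rw [← hab]
      exact Ideal.add_mem _ (Ideal.mul_mem_left _ _ hX₀q) (Ideal.mul_mem_left _ _ hY₂q)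
  -- INDUCTION along `k`
  have hS : ∀ k : ℕ, 2 ≤ k → (∀ k', 2 ≤ k' → k' < k → k' * q < r) →
      ∃ Y : T, Ideal.span ({X₀, Y} : Set T) = Ideal.span {u, v} ∧ φ Y ∈ Ideal.span {y₁, φ X₀ ^ k} := by
    intro k hk
    induction k, hk using Nat.le_induction with
    | base => exact fun _ => ⟨Y₂, hX₀Y₂, hY₂2⟩
    | succ k hk ih =>
      intro hlt
      obtain ⟨Y, hXY, hYk⟩ := ih fun k' h1 h2 => hlt k' h1 (Nat.lt_succ_of_lt h2)
      have hkq : k * q < r := hlt k hk (Nat.lt_succ_self k)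
      obtain ⟨c, hc⟩ := exists_sub_mul_pow_mem_span (Ideal.span ({u, v} : Set T)) hq1' hdimO hXY (hnot2 Y hXY) hν1 hmemν'
        hgν1 hadm' hk hkq hYk
      refine ⟨Y - c * X₀ ^ k, ?_, hc⟩
      rw [← hXY]
      obtain ⟨k', rfl⟩ : ∃ k', k = k' + 1 := ⟨k - 1, by omega⟩
      have : Y - c * X₀ ^ (k' + 1) = Y + X₀ * (-(c * X₀ ^ k')) := by ring
      rw [this, Ideal.span_pair_add_left_mul]
  -- the least `m ≥ 2` with `m q ≥ r`
  have hex : ∃ m : ℕ, 2 ≤ m ∧ r ≤ m * q := ⟨r + 2, by omega, by nlinarith⟩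
  obtain ⟨Y, hXY, hYm⟩ := hS (Nat.find hex) (Nat.find_spec hex).1 fun k' h1 h2 => by
    by_contra h
    exact Nat.find_min hex h2 ⟨h1, by omega⟩
  have hmq : r ≤ Nat.find hex * q := (Nat.find_spec hex).2
  have hm2 : 2 ≤ Nat.find hex := (Nat.find_spec hex).1
  -- CONCLUSION: `g/1 ∈ 𝒥_{rν}((Y, X₀); (r, q))`
  have h𝔪Y := h𝔪O' Y hXY
  obtain ⟨-, hφY2⟩ := LocalGameEFTSteepening.not_mem_sq_of_span_pair_eq hdimO h𝔪Y
  obtain ⟨a, γ, haγ⟩ := Ideal.mem_span_pair.mp hYm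
  have hau : IsUnit a := by
    by_contra hau
    have ha𝔪 : a ∈ maximalIdeal O := (IsLocalRing.mem_maximalIdeal _).mpr (mem_nonunits_iff.mpr hau)
    apply hφY2
    rw [← haγ]
    refine Ideal.add_mem _ (by rw [pow_two]; exact Ideal.mul_mem_mul ha𝔪 hy₁𝔪)
      (Ideal.mul_mem_left _ γ (Ideal.pow_le_pow_right hm2 (Ideal.pow_mem_pow hφX₀𝔪 _)))
  have hfinal : φ g ∈ weightedMonomialIdeal ![φ Y, φ X₀] ![r, q] (r * ν) := by
    refine weightedMonomialIdeal_le_of_forall_mem ![φ Y, φ X₀] ![y₁, φ X₀] ![r, q] (fun i => ?_) (r * ν) hadm'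
    fin_cases i
    · change y₁ ∈ weightedMonomialIdeal ![φ Y, φ X₀] ![r, q] r
      obtain ⟨a, rfl⟩ := hau
      have hy : y₁ = ↑a⁻¹ * φ Y + (-(↑a⁻¹ * γ)) * φ X₀ ^ Nat.find hex := by
        rw [← haγ, mul_add, ← mul_assoc, Units.inv_mul, one_mul]; ring
      rw [hy]
      refine Ideal.add_mem _ (Ideal.mul_mem_left _ _ (Ideal.subset_span ⟨![1, 0], by simp, by simp⟩))
        (Ideal.mul_mem_left _ _ (Ideal.subset_span ⟨![0, Nat.find hex], ?_, by simp⟩))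
      simp only [Fin.sum_univ_two, Matrix.cons_val_zero, Matrix.cons_val_one, mul_zero, zero_add]
      rw [Nat.mul_comm]; exact hmq
    · exact Ideal.subset_span ⟨![0, 1], by simp, by simp⟩
  obtain ⟨hPXY, hm⟩ := exists_adm_of_eq T hXY.symm (a := Y) (b := X₀) hfinal
  exact ⟨X₀, Y, z, hPXY, hrsp Y hXY, by rw [hXY, huv], hm⟩

/-- **(desc-τ) IN THE DOOR SETTING, UNCONDITIONAL**: for `T` regular local essentially of finite type over a field and `φ : T → T'` local, formally smooth,
essentially of finite type into a regular local `T'` with `dim T' ≤ 3`, tie positions descend: `IsTiePosition T' (φ g) → IsTiePosition T g`.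
[OURS · (desc-τ) door setting] [cite: AbramovichQuekSchober2025, Thm 1.3, Thm 3.5] -/
theorem isTiePosition_descent_door (k₀ : Type) [Field k₀] [Algebra k₀ T] [Algebra.EssFiniteType k₀ T] {g : T}
    (_hdimT' : ringKrullDim T' ≤ 3) (ht' : IsTiePosition T' (algebraMap T T' g)) : IsTiePosition T g := by
  obtain ⟨h3', h2 | h3⟩ := ringKrullDim_eq_of_isTiePosition_map T T' ht'
  · exact absurd ht' (not_isTiePosition_map_of_ringKrullDim_eq_two T T' k₀ h2 g)
  · obtain ⟨_, -, -, -, x', y', z', q, r, lam', h'⟩ := id ht'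
    obtain ⟨-, -, ν, hP', hfν, hfν1, hlex, -⟩ := id h'
    obtain ⟨-, hpos, hcop, hqr, -⟩ := hlex
    rcases (show q ≤ r from hqr).eq_or_lt with hqr_eq | hlt
    · subst hqr_eq
      have hq1 : q = 1 := by
        have hc : Nat.Coprime q q := hcop
        unfold Nat.Coprime at hc
        rwa [Nat.gcd_self] at hc
      subst hq1
      exact isTiePosition_descent_of_weights_one T T' h3 ht' h'
    · obtain ⟨x, y, z, hP, hxyz, hP₀, hmem⟩ := exists_adapted_admissible T T' k₀ h3 ht' h' hlt hfν hfν1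
      haveI := hP
      exact isTiePosition_of_adapted_admissible T T' h3 ht' h' hfν hfν1 hxyz hP₀ hmem

end Adm

end Iota3

end Summit.ResolutionOfSingularities.ResolutionOfSingularities.Cruxes.HypersurfaceCentreConstruction.LocalEngine

end
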